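import Mathlib
import Summits.CriticalPhenomena.SAWScalingLimit.Theses.SAWLeftRightFKG
import Literature.Probability.RandomPlanarGeometry.EdgeFugacitySAW
import Literature.Probability.RandomPlanarGeometry.SAWRenewalBound

/-!
# Sketch — crux-ideate `stmt-CriticalPhenomena-11232` (`LeftRightFKG`), ideator 1, round 1

First lemmas of the idea cards (they must ELABORATE; proofs are not claimed):

* `CornerLocalisation` (card `idea-corner-localisation`): the fugacity-blind REDUCTION
  `CornerY → PAY` (positive association of the edge-weighted chord measure is decided by ONE
  covariance per instance: the two "leftmost-edge" corner events at the marked points), and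
  `PAY → LeftRightFKG` (specialise the edge weights to `x_c`).
* `KestenSwitching` (card `idea-kesten-loop-towers`): the first-meeting double-switching identity is
  combinatorial; its first checkable lemma is the corner inequality at `x_c` for the edge-weighted
  class, `CornerXc`, which with the reduction gives the crux.
* `HiddenFerromagnet` / `GermCloud` (representation levers, kept only if the toy programmes are
  feasible): monotone images of FKG measures are positively associated (Mathlib `fkg`), and the
  existence statements of the lifts over the crux's own carrier.
-/

open MeasureTheory
open Literature.Probability.LatticeModels Literature.Probability.RandomPlanarGeometry
open scoped Classical

namespace Summit.CriticalPhenomena.SAWScalingLimit.Cruxes.LeftRightFKG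

/-! ## Common vocabulary over the crux's carrier -/

/-- The lattice sites enclosed by the closed lattice walk `C` (winding number `≠ 0` of its
unit-mesh polyline): the vertex set of the discrete domain, as in the crux but at mesh `1`. -/
noncomputable def encl {c : Site 2} (C : (zdGraph 2).Walk c c) : Set (Site 2) :=
  {v | Literature.Topology.PlaneTopology.wind
        (fun t : ℝ => Set.IccExtend zero_le_one (C.toCurve (meshPoint 1)) t - meshPoint 1 v) ≠ 0}

/-- The left–right order of two chords (walks of `ℤ²` with the same endpoints): the lens loop
`γ₁ · γ₂⁻¹` has winding `≥ 0` everywhere — verbatim the crux's `le`, at mesh `1`. -/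
noncomputable def lrLE {a b : Site 2} (γ₁ γ₂ : (zdGraph 2).Walk a b) : Prop :=
  ∀ z : ℂ, 0 ≤ Literature.Topology.PlaneTopology.wind
    (fun t : ℝ => Set.IccExtend zero_le_one ((γ₁.append γ₂.reverse).toCurve (meshPoint 1)) t - z)

/-- Edge-weighted chord measure on SAWs of `ℤ²` through the site set `S` from `a` to `b`
(`SAW.edgeFugacityWeight`, Grimmett–Li weighted SAW): weight `∏_{darts} y u v`. With
`y ≡ x_c` this is the critical weight; `y(e) = 0` on a boundary edge emulates deleting it. -/
noncomputable abbrev wY (y : Site 2 → Site 2 → ℝ) (S : Set (Site 2)) (a b : Site 2) :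
    Measure (SAW.RestrictedSAW (zdGraph 2) S a b) :=
  SAW.edgeFugacityWeight (zdGraph 2) y S a b

/-- `A` is an up-set of chords for the left–right order. -/
def IsUpSet {S : Set (Site 2)} {a b : Site 2} (A : Set (SAW.RestrictedSAW (zdGraph 2) S a b)) : Prop :=
  ∀ γ₁ γ₂, lrLE γ₁.walk γ₂.walk → γ₁ ∈ A → γ₂ ∈ A

/-- `A` depends only on the first step of the chord. -/
def FirstStepEvent {S : Set (Site 2)} {a b : Site 2} (A : Set (SAW.RestrictedSAW (zdGraph 2) S a b)) :
    Prop :=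
  ∀ γ₁ γ₂, γ₁.walk.getVert 1 = γ₂.walk.getVert 1 → (γ₁ ∈ A ↔ γ₂ ∈ A)

/-- `B` depends only on the last step of the chord. -/
def LastStepEvent {S : Set (Site 2)} {a b : Site 2} (B : Set (SAW.RestrictedSAW (zdGraph 2) S a b)) :
    Prop :=
  ∀ γ₁ γ₂, γ₁.walk.reverse.getVert 1 = γ₂.walk.reverse.getVert 1 → (γ₁ ∈ B ↔ γ₂ ∈ B)

/-! ## Card A — corner localisation (fugacity-blind reduction) -/

/-- **PA for the edge-weighted class.** For every simply connected lattice domain `encl C`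
(slits allowed), endpoints adjacent to the boundary walk, and every symmetric nonnegative edge
weight `y`, the weighted chord measure is positively associated in the left–right order. -/
def PAY : Prop :=
  ∀ (c a b a' b' : Site 2) (C : (zdGraph 2).Walk c c) (y : Site 2 → Site 2 → ℝ),
    a' ∈ C.support → b' ∈ C.support → (zdGraph 2).Adj a a' → (zdGraph 2).Adj b b' →
    (∀ u v, 0 ≤ y u v) → (∀ u v, y u v = y v u) →
    ∀ A B : Set (SAW.RestrictedSAW (zdGraph 2) (encl C) a b), IsUpSet A → IsUpSet B →
      wY y (encl C) a b A * wY y (encl C) a b B ≤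
        wY y (encl C) a b Set.univ * wY y (encl C) a b (A ∩ B)

/-- **Corner positivity for the edge-weighted class**: the same inequality, demanded ONLY for an
up-set `A` determined by the first step and an up-set `B` determined by the last step (i.e.
`Cov(avoid the leftmost edge at a, avoid the leftmost edge at b) ≥ 0`; in the two-neighbour case
the `2 × 2` minor `Z_{UV} Z_{UᶜVᶜ} ≥ Z_{UVᶜ} Z_{UᶜV}`). -/
def CornerY : Prop :=
  ∀ (c a b a' b' : Site 2) (C : (zdGraph 2).Walk c c) (y : Site 2 → Site 2 → ℝ),
    a' ∈ C.support → b' ∈ C.support → (zdGraph 2).Adj a a' → (zdGraph 2).Adj b b' →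
    (∀ u v, 0 ≤ y u v) → (∀ u v, y u v = y v u) →
    ∀ A B : Set (SAW.RestrictedSAW (zdGraph 2) (encl C) a b), IsUpSet A → IsUpSet B →
      FirstStepEvent A → LastStepEvent B →
      wY y (encl C) a b A * wY y (encl C) a b B ≤
        wY y (encl C) a b Set.univ * wY y (encl C) a b (A ∩ B)

/-- **First lemma of card A (the reduction theorem).** Corner positivity for all instances of the
edge-weighted class implies positive association for all instances: split on the first-step
corner event `E` (conditional measures are again instances: `y(e_a) := 0`, resp. the domain
`encl C'` with `C'` = `C` spliced with the backtrack `a' → a → a'`), positive association of the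
pieces by induction, two-point Chebyshev from the endpoint monotonicity
`μ(·|Eᶜ) ≼ μ(·|E)`, which in turn follows by decomposing over the last-step corner event `F`,
the induction hypotheses and `Cov(1_E, 1_F) ≥ 0` = `CornerY`. Induction on the number of
positive-weight edges. No input at `x_c`. -/
theorem cornerY_imp_PAY : CornerY → PAY := by
  sorry

/-- **Specialisation.** With `y ≡ x_c` the edge weight is `x_c^{|γ|}` (`dartWeight_const`), the
carrier `SAW.RestrictedSAW (zdGraph 2) (encl C) a b` at mesh `1` matches the crux's `DomainSAW Ω δ a b`
(scaling `δ` is immaterial; the crux's `Ω`-sites are `encl C`), so `PAY` gives the crux. -/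
theorem PAY_imp_crux :
    PAY → Summit.CriticalPhenomena.SAWScalingLimit.Theses.SAWLeftRightFKG.LeftRightFKG := by
  sorry

/-! ## Card B′ — Kesten loop towers (the `x ≤ x_c` input for the corner inequality) -/

/-- The corner inequality at sub-critical-or-critical edge weights `0 ≤ y ≤ x_c`: the target of the
first-meeting double-switching / loop-tower line. -/
def CornerXc : Prop :=
  ∀ (c a b a' b' : Site 2) (C : (zdGraph 2).Walk c c) (y : Site 2 → Site 2 → ℝ),
    a' ∈ C.support → b' ∈ C.support → (zdGraph 2).Adj a a' → (zdGraph 2).Adj b b' →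
    (∀ u v, 0 ≤ y u v) → (∀ u v, y u v ≤ SAW.criticalFugacity) → (∀ u v, y u v = y v u) →
    ∀ A B : Set (SAW.RestrictedSAW (zdGraph 2) (encl C) a b), IsUpSet A → IsUpSet B →
      FirstStepEvent A → LastStepEvent B →
      wY y (encl C) a b A * wY y (encl C) a b B ≤
        wY y (encl C) a b Set.univ * wY y (encl C) a b (A ∩ B)

/-- The finite Kesten input in the tree: a Kraft sum of irreducible bridges exceeding `1` at `ρ⁻¹`
forces `ρ ≤ μ`; contrapositively every finite family of irreducible bridges has
`Σ x_c^{|s|}`-type sums controlled at `x_c = 1/μ` — the only exact `x_c`-characterisation on `ℤ²`,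
and the bound the loop-tower insertion series must be dominated by. (Re-export, to pin the decl.) -/
theorem kesten_kraft_input {S : Finset (List SAW.Step)} (hS : SAW.Renewal.Admissible S)
    (hE : [(0 : SAW.Step)] ∈ S) {ρ : ℝ} (hρ : 0 < ρ) (hK : 1 ≤ ∑ s ∈ S, ρ⁻¹ ^ s.length) :
    ρ ≤ SAW.connectiveConstant :=
  SAW.Renewal.le_connectiveConstant_of_kraft hS hE hρ hK

/-- **First lemma of card B′ as used**: the corner inequality at weights `≤ x_c` (to be proved by
loop towers) feeds the fugacity-blind reduction restricted to weights `≤ x_c` (the induction only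
zeroes edges, so the bound `y ≤ x_c` is preserved) and gives the crux. -/
theorem cornerXc_imp_crux :
    CornerXc → Summit.CriticalPhenomena.SAWScalingLimit.Theses.SAWLeftRightFKG.LeftRightFKG := by
  sorry

/-! ## Card C — representation levers (hidden ferromagnet / germ cloud) -/

/-- A monotone image of a log-supermodular weight on a finite distributive lattice is positively
associated for monotone nonnegative observables: Mathlib's `fkg` composed with the monotone map. -/
theorem fkg_image {α β P : Type*} [DistribLattice α] [Fintype α] [Preorder P]
    [CommSemiring β] [LinearOrder β] [IsStrictOrderedRing β] [ExistsAddOfLE β]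
    (μ : α → β) (π : α → P) (f g : P → β) (hμ₀ : 0 ≤ μ) (hf₀ : 0 ≤ f) (hg₀ : 0 ≤ g)
    (hπ : Monotone π) (hf : Monotone f) (hg : Monotone g)
    (hμ : ∀ a b, μ a * μ b ≤ μ (a ⊓ b) * μ (a ⊔ b)) :
    (∑ a, μ a * f (π a)) * ∑ a, μ a * g (π a) ≤ (∑ a, μ a) * ∑ a, μ a * (f (π a) * g (π a)) :=
  fkg (f ∘ π) (g ∘ π) μ hμ₀ (fun a => hf₀ (π a)) (fun a => hg₀ (π a)) (hf.comp hπ) (hg.comp hπ) hμ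

/-- **Hidden ferromagnet (lift existence) for one instance**: there is a log-supermodular weight
`μ ≥ 0` on a finite Boolean lattice `Finset (Fin n)` and an order-preserving map `π` onto the
chords whose push-forward is exactly the critical weight `x_c^{|γ|}`. -/
def HasFKGLift (S : Set (Site 2)) (a b : Site 2) : Prop :=
  ∃ (n : ℕ) (μ : Finset (Fin n) → ℝ) (π : Finset (Fin n) → SAW.RestrictedSAW (zdGraph 2) S a b),
    (∀ s, 0 ≤ μ s) ∧ (∀ s t, μ s * μ t ≤ μ (s ⊓ t) * μ (s ⊔ t)) ∧
    (∀ s t, s ≤ t → lrLE (π s).walk (π t).walk) ∧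
    ∀ γ, (∑ s ∈ Finset.univ.filter (fun s => π s = γ), μ s) =
      SAW.criticalFugacity ^ γ.walk.length

/-- **Germ cloud (max-infinite divisibility) for one instance**: the "CDF" `η ↦ Z{γ ≼ η}/Z` of the
critical chord is a product of two-point factors — finitely many germ chords `g i` carried
independently with intensities `ν i ≥ 0`, the chord being the join of the present germs:
`P(γ ≼ η) = exp(-Σ_{i : g i ⋠ η} ν i)`. -/
def HasGermCloud (S : Set (Site 2)) (a b : Site 2) : Prop :=
  ∃ (n : ℕ) (g : Fin n → SAW.RestrictedSAW (zdGraph 2) S a b) (ν : Fin n → ℝ), (∀ i, 0 ≤ ν i) ∧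
    ∀ η : SAW.RestrictedSAW (zdGraph 2) S a b,
      wY (fun _ _ => SAW.criticalFugacity) S a b {γ | lrLE γ.walk η.walk} =
        wY (fun _ _ => SAW.criticalFugacity) S a b Set.univ *
          ENNReal.ofReal (Real.exp (-(∑ i ∈ Finset.univ.filter (fun i => ¬ lrLE (g i).walk η.walk),
            ν i)))

/-- **First lemma of card C**: an FKG lift of every instance gives the crux (monotone image of an
FKG measure, `fkg_image`, plus the carrier identification of `PAY_imp_crux`). -/
theorem fkgLift_imp_crux
    (h : ∀ (c a b a' b' : Site 2) (C : (zdGraph 2).Walk c c), a' ∈ C.support → b' ∈ C.support →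
      (zdGraph 2).Adj a a' → (zdGraph 2).Adj b b' → HasFKGLift (encl C) a b) :
    Summit.CriticalPhenomena.SAWScalingLimit.Theses.SAWLeftRightFKG.LeftRightFKG := by
  sorry

end Summit.CriticalPhenomena.SAWScalingLimit.Cruxes.LeftRightFKG
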